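import Summits.PneNP.PneNP.Theses.LyapunovRefutations
import Summits.PneNP.PneNP.Theorems.RamseyUncertifiableRegularResolutionRungResDag

/-!
# Route LyapunovRefutations — `OrderedResolutionUpperBoundFC` (stmt-PneNP-10889), part 1: dag paths

Helper file (1/3) for the support item `OrderedResolutionUpperBoundFC`: ordered resolution embeds
into the forward-complete class of layered max-linear certificates. This part is the combinatorics
of conclusion-to-premise dag paths of a resolution derivation `π` (no certificate yet):

* unpacking `IsValidResLine` for the three rules (`valid_resolve`, `valid_weaken`, `valid_initial`);
* reachability "`u` is reached from `t`" — `∃ p, IsDagPath prem (t :: p) ∧ last (t :: p) = u`,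
  always written out (the file introduces no definition) — and its closure properties;
* the KEY LEMMA `lit_mem_or_pivot` (needs no ordering; cf. the positional `persistence_mono` of
  `RamseyUncertifiableRegularResolutionRungResDag`, whose `dagPath_mem_lt` is reused here): a
  literal of the last line of a dag path belongs to the clause of the first line or is the pivot
  of a resolution step met on the path — literals only disappear upwards by being resolved upon,
  weakenings only add literals;
* the ORDERING LEMMA `pivot_lt_of_mem_path`: if pivots strictly increase along dag paths, then on
  a path starting at a resolution line with pivot `v` every later pivot is `> v`;
* every line reaches, through weakenings only, a non-weakening line contained in it
  (`exists_chainEnd`), and reaches an initial line (`exists_leaf`).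
[cite: KrajicekProofComplexity2019, §5.1, §5.6]
-/

set_option linter.dupNamespace false -- `Summit.PneNP.PneNP.…`: summit = sub-problem name (D-0017 single-conjunct layout)

namespace Summit.PneNP.PneNP.Theorems

open Literature.Computability.Complexity Literature.Computability.MetaComplexity
open Summit.PneNP.PneNP.Cruxes.RegularResolutionRung.SoundPathBottleneck (dagPath_mem_lt)

namespace OrderedResFC

variable {φ : CNF ℕ} {π : List (ResLine ℕ)}

/-! ### Dag paths and reachability -/

/-- Decomposition of a dag path at its first edge. [folklore] -/
theorem isDagPath_cons_cons {t s : ℕ} {p : List ℕ}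
    (hp : IsDagPath (π.map ResLine.premises) (t :: s :: p)) :
    ∃ ht : t < π.length, s ∈ (π[t]).premises ∧ IsDagPath (π.map ResLine.premises) (s :: p) := by
  have ht : t < π.length := dagPath_mem_lt hp (by simp)
  refine ⟨ht, ?_, ?_⟩
  · have h := (List.isChain_cons_cons.1 hp.2).1
    rw [List.getD_eq_getElem?_getD, List.getElem?_map, List.getElem?_eq_getElem ht] at h
    simpa using h
  · exact ⟨fun i hi => hp.1 i (by simp [hi]), (List.isChain_cons_cons.1 hp.2).2⟩

/-- Composition of a dag path with a first edge. [folklore] -/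
theorem isDagPath_cons {t s : ℕ} {p : List ℕ} (ht : t < π.length) (hs : s ∈ (π[t]).premises)
    (hp : IsDagPath (π.map ResLine.premises) (s :: p)) :
    IsDagPath (π.map ResLine.premises) (t :: s :: p) := by
  refine ⟨fun i hi => ?_, List.isChain_cons_cons.2 ⟨?_, hp.2⟩⟩
  · rcases List.mem_cons.1 hi with rfl | hi
    · simpa using ht
    · exact hp.1 i hi
  · rw [List.getD_eq_getElem?_getD, List.getElem?_map, List.getElem?_eq_getElem ht]
    simpa using hs

/-- The one-element path. [folklore] -/
theorem isDagPath_singleton {t : ℕ} (ht : t < π.length) :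
    IsDagPath (π.map ResLine.premises) [t] :=
  ⟨fun i hi => by simp at hi; simpa [hi] using ht, List.isChain_singleton t⟩

/-- Reachability is reflexive on line indices. [folklore] -/
theorem reach_self {t : ℕ} (ht : t < π.length) : (∃ p₀ : List ℕ, IsDagPath (List.map
    ResLine.premises π) (t :: p₀) ∧ (t :: p₀).getLast (List.cons_ne_nil t p₀) = t) :=
  ⟨[], isDagPath_singleton ht, by simp⟩

/-- Prepending an edge to a reachability witness. [folklore] -/
theorem reach_cons {t s u : ℕ} (ht : t < π.length) (hs : s ∈ (π[t]).premises)
    (h : (∃ p₀ : List ℕ, IsDagPath (List.map ResLine.premises π) (s :: p₀) ∧ (s :: p₀).getLast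
        (List.cons_ne_nil s p₀) = u)) : (∃ p₀ : List ℕ, IsDagPath (List.map ResLine.premises π) (t
        :: p₀) ∧ (t :: p₀).getLast (List.cons_ne_nil t p₀) = u) := by
  obtain ⟨p, hp, hl⟩ := h
  exact ⟨s :: p, isDagPath_cons ht hs hp, by simpa using hl⟩

/-- Reachability is transitive. [folklore] -/
theorem reach_trans {t u w : ℕ} (h₁ : (∃ p₀ : List ℕ, IsDagPath (List.map ResLine.premises π) (t ::
    p₀) ∧ (t :: p₀).getLast (List.cons_ne_nil t p₀) = u)) (h₂ : (∃ p₀ : List ℕ, IsDagPath (List.map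
    ResLine.premises π) (u :: p₀) ∧ (u :: p₀).getLast (List.cons_ne_nil u p₀) = w)) : (∃ p₀ : List
    ℕ, IsDagPath (List.map ResLine.premises π) (t :: p₀) ∧ (t :: p₀).getLast (List.cons_ne_nil t p₀)
    = w) := by
  obtain ⟨p, hp, hl⟩ := h₁
  induction p generalizing t with
  | nil =>
    simp only [List.getLast_singleton] at hl
    exact hl ▸ h₂
  | cons s p ih =>
    obtain ⟨ht, hs, hp'⟩ := isDagPath_cons_cons hp
    refine reach_cons ht hs (ih hp' ?_)
    simpa using hl

/-! ### Unpacking validity of lines -/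

/-- A resolution line has earlier premises and is their resolvent. [folklore] -/
theorem valid_resolve (hder : IsResDerivation φ π) {t : ℕ} (ht : t < π.length) {s₁ s₂ v : ℕ}
    (hr : (π[t]).rule = .resolve s₁ s₂ v) :
    ∃ (h₁ : s₁ < t) (h₂ : s₂ < t), IsResolvent (π[s₁]'(h₁.trans ht)).clause
      (π[s₂]'(h₂.trans ht)).clause v (π[t]).clause := by
  have h := hder t ht
  unfold IsValidResLine at h
  rw [hr] at h
  obtain ⟨h₁, h₂, hres⟩ := h
  have h₁' : s₁ < t := by rw [List.length_take] at h₁; exact (lt_min_iff.1 h₁).1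
  have h₂' : s₂ < t := by rw [List.length_take] at h₂; exact (lt_min_iff.1 h₂).1
  refine ⟨h₁', h₂', ?_⟩
  simpa [List.getElem_take] using hres

/-- A weakening line has an earlier premise, which it contains. [folklore] -/
theorem valid_weaken (hder : IsResDerivation φ π) {t : ℕ} (ht : t < π.length) {s : ℕ}
    (hr : (π[t]).rule = .weaken s) :
    ∃ (h₁ : s < t), (π[s]'(h₁.trans ht)).clause ⊆ (π[t]).clause := by
  have h := hder t ht
  unfold IsValidResLine at h
  rw [hr] at h
  obtain ⟨h₁, hsub⟩ := h
  have h₁' : s < t := by rw [List.length_take] at h₁; exact (lt_min_iff.1 h₁).1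
  refine ⟨h₁', ?_⟩
  simpa [List.getElem_take] using hsub

/-- An initial line is a clause of `φ`. [folklore] -/
theorem valid_initial (hder : IsResDerivation φ π) {t : ℕ} (ht : t < π.length)
    (hr : (π[t]).rule = .initial) : ∃ i : Fin φ.length, (π[t]).clause = (φ[i]).toFinset := by
  have h := hder t ht
  unfold IsValidResLine at h
  rw [hr] at h
  change (π[t]).clause ∈ φ.map List.toFinset at h
  obtain ⟨c, hc, hct⟩ := List.mem_map.1 h
  obtain ⟨i, hi, rfl⟩ := List.mem_iff_getElem.1 hc
  exact ⟨⟨i, hi⟩, hct.symm⟩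

/-- The premises of a line, by rule. [folklore] -/
theorem premises_eq {t : ℕ} (ht : t < π.length) :
    (π[t]).premises = (π[t]).rule.premises := rfl

/-- `clause[π](t)` in range. [folklore] -/
theorem clauseOf_eq {t : ℕ} (ht : t < π.length) : (if h₀ : t < List.length π then (π[t]'h₀).clause
    else (∅ : Finset (Literal ℕ))) = (π[t]).clause := by
  rw [dif_pos ht]

/-- `pivot[π](t)` in range. [folklore] -/
theorem pivotOf_eq {t : ℕ} (ht : t < π.length) : (π[t]?.bind fun l₀ : ResLine ℕ =>
    l₀.rule.pivot?) = (π[t]).rule.pivot? := by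
  rw [List.getElem?_eq_getElem ht]
  rfl

/-! ### The key lemma and the ordering lemma -/

/-- **Key lemma (no ordering needed).** A literal of the last line of a conclusion-to-premise dag
path either belongs to the clause of the first line or is the pivot of a resolution step met on
the path: literals only disappear upwards by being resolved upon (weakenings only add literals).
[cite: KrajicekProofComplexity2019, §5.1] -/
theorem lit_mem_or_pivot (hder : IsResDerivation φ π) :
    ∀ (p : List ℕ) (t : ℕ), IsDagPath (π.map ResLine.premises) (t :: p) →
      ∀ l ∈ (if h₀ : ((t :: p).getLast (List.cons_ne_nil t p)) < List.length π then (π[((t ::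
          p).getLast (List.cons_ne_nil t p))]'h₀).clause else (∅ : Finset (Literal ℕ))),
        l ∈ (if h₀ : t < List.length π then (π[t]'h₀).clause else (∅ : Finset (Literal
            ℕ))) ∨ ∃ w ∈ t :: p, (π[w]?.bind fun l₀ : ResLine ℕ => l₀.rule.pivot?) = some l.1
  | [], t, _, l, hl => Or.inl (by simpa using hl)
  | s :: p, t, hp, l, hl => by
    obtain ⟨ht, hs, hp'⟩ := isDagPath_cons_cons hp
    have hl' : l ∈ (if h₀ : ((s :: p).getLast (List.cons_ne_nil s p)) < List.length π then (π[((s ::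
        p).getLast (List.cons_ne_nil s p))]'h₀).clause else (∅ : Finset (Literal ℕ))) := by
      simpa using hl
    rcases lit_mem_or_pivot hder p s hp' l hl' with hmem | ⟨w, hw, hpw⟩
    · have hs' : s < π.length := dagPath_mem_lt hp' (by simp)
      rw [clauseOf_eq hs'] at hmem
      rw [clauseOf_eq ht]
      rw [premises_eq ht] at hs
      cases hr : (π[t]).rule with
      | initial => simp [hr, ResRule.premises] at hs
      | weaken s' =>
        simp only [hr, ResRule.premises, List.mem_singleton] at hs
        subst hs
        obtain ⟨h₁, hsub⟩ := valid_weaken hder ht hr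
        exact Or.inl (hsub hmem)
      | resolve s₁ s₂ v =>
        obtain ⟨h₁, h₂, hpos, hneg, hE⟩ := valid_resolve hder ht hr
        simp only [hr, ResRule.premises, List.mem_cons, List.not_mem_nil, or_false] at hs
        have hpt : (π[t]?.bind fun l₀ : ResLine ℕ => l₀.rule.pivot?) = some v := by
          rw [pivotOf_eq ht, hr]; rfl
        rcases hs with rfl | rfl
        · by_cases hlv : l = (v, true)
          · exact Or.inr ⟨t, by simp, by rw [hpt, hlv]⟩
          · left
            rw [hE]
            exact Finset.mem_union_left _ (Finset.mem_erase.2 ⟨hlv, hmem⟩)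
        · by_cases hlv : l = (v, false)
          · exact Or.inr ⟨t, by simp, by rw [hpt, hlv]⟩
          · left
            rw [hE]
            exact Finset.mem_union_right _ (Finset.mem_erase.2 ⟨hlv, hmem⟩)
    · exact Or.inr ⟨w, List.mem_cons_of_mem t hw, hpw⟩

/-- **Ordering lemma.** On a dag path starting at a resolution line with pivot `v`, every pivot
met later on the path is `> v`, provided pivots strictly increase along dag paths.
[cite: KrajicekProofComplexity2019, §5.6] -/
theorem pivot_lt_of_mem_path
    (hord : ∀ p, IsDagPath (π.map ResLine.premises) p → (pivotsAlong π p).Pairwise (· < ·))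
    {t : ℕ} {p : List ℕ} (hp : IsDagPath (π.map ResLine.premises) (t :: p)) {v : ℕ}
    (hv : (π[t]?.bind fun l₀ : ResLine ℕ => l₀.rule.pivot?) = some v) {w : ℕ} (hw : w ∈ p) {v' :
        ℕ} (hv' : (π[w]?.bind fun l₀ : ResLine ℕ => l₀.rule.pivot?) = some v') :
    v < v' := by
  have h := hord _ hp
  unfold pivotsAlong at h
  rw [List.filterMap_cons_some (f := fun i => π[i]?.bind fun l => l.rule.pivot?) (a := t) (l := p)
      hv,
    List.pairwise_cons] at h
  exact h.1 v' (List.mem_filterMap.2 ⟨w, hw, hv'⟩)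

/-! ### Weakening chains and leaves -/

/-- Every line reaches, through weakenings only, a non-weakening line contained in it.
[folklore] -/
theorem exists_chainEnd (hder : IsResDerivation φ π) :
    ∀ (t : ℕ) (ht : t < π.length), ∃ u, (∃ p₀ : List ℕ, IsDagPath (List.map ResLine.premises π) (t
        :: p₀) ∧ (t :: p₀).getLast (List.cons_ne_nil t p₀) = u) ∧ ∃ hu : u < π.length,
      (∀ s, (π[u]).rule ≠ .weaken s) ∧ (π[u]).clause ⊆ (π[t]'ht).clause := by
  intro t
  induction t using Nat.strong_induction_on with
  | _ t ih =>
    intro ht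
    cases hr : (π[t]).rule with
    | initial => exact ⟨t, reach_self ht, ht, fun s => by simp [hr], subset_rfl⟩
    | resolve s₁ s₂ v => exact ⟨t, reach_self ht, ht, fun s => by simp [hr], subset_rfl⟩
    | weaken s =>
      obtain ⟨hs, hsub⟩ := valid_weaken hder ht hr
      obtain ⟨u, hu, hu', hnw, husub⟩ := ih s hs (hs.trans ht)
      refine ⟨u, reach_cons ht ?_ hu, hu', hnw, husub.trans hsub⟩
      rw [premises_eq ht, hr]
      simp [ResRule.premises]

/-- Every line reaches an initial line (a leaf of its sub-dag). [folklore] -/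
theorem exists_leaf (hder : IsResDerivation φ π) :
    ∀ t < π.length, ∃ u, (∃ p₀ : List ℕ, IsDagPath (List.map ResLine.premises π) (t :: p₀) ∧ (t ::
        p₀).getLast (List.cons_ne_nil t p₀) = u) ∧ ∃ hu : u < π.length,
      (π[u]).rule = .initial ∧ ∃ i : Fin φ.length, (π[u]).clause = (φ[i]).toFinset := by
  intro t
  induction t using Nat.strong_induction_on with
  | _ t ih =>
    intro ht
    cases hr : (π[t]).rule with
    | initial => exact ⟨t, reach_self ht, ht, hr, valid_initial hder ht hr⟩
    | resolve s₁ s₂ v =>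
      obtain ⟨h₁, -, -⟩ := valid_resolve hder ht hr
      obtain ⟨u, hu, hu', hinit, hi⟩ := ih s₁ h₁ (h₁.trans ht)
      refine ⟨u, reach_cons ht ?_ hu, hu', hinit, hi⟩
      rw [premises_eq ht, hr]
      simp [ResRule.premises]
    | weaken s =>
      obtain ⟨hs, -⟩ := valid_weaken hder ht hr
      obtain ⟨u, hu, hu', hinit, hi⟩ := ih s hs (hs.trans ht)
      refine ⟨u, reach_cons ht ?_ hu, hu', hinit, hi⟩
      rw [premises_eq ht, hr]
      simp [ResRule.premises]

/-- A dag path starting at an initial line is trivial. [folklore] -/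
theorem eq_nil_of_initial {t : ℕ} {p : List ℕ} (hp : IsDagPath (π.map ResLine.premises) (t :: p))
    (ht : t < π.length) (hr : (π[t]).rule = .initial) : p = [] := by
  cases p with
  | nil => rfl
  | cons s p =>
    obtain ⟨ht', hs, -⟩ := isDagPath_cons_cons hp
    rw [premises_eq ht', hr] at hs
    simp [ResRule.premises] at hs

end OrderedResFC

end Summit.PneNP.PneNP.Theorems
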